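import Literature.RingTheory.NoetherNormalization.LinearChange
import Literature.AlgebraicGeometry.Motives.CurveThroughTwoPointsHypersurfaceModel

/-!
# LangWeilTransfer, support item `TameResolution` (stmt-ValiantsHypothesis-6378) — the integer
# shear of one Noether round, with the height bound

Route `LangWeilTransfer` of `ValiantsHypothesis` (conditional route; honest framing: bookkeeping,
nothing here bears on VP ≠ VNP). Quantitative pass, step (C) of the roadmap note of val-lit-p6 g9:
the round of `exists_shear_isIntegral_nat` (`LangWeilTransferTameResolutionNoether`) run on a GIVEN
relation `f` (in the quantitative Noether loop: the relation of one coordinate produced by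
`eliminant_identity_coord`), exporting the height bound `w_k ≤ deg f` of the shear vector
(Literature `exists_linearChange_monic` with the node set `{0, …, deg f}`).

* `exists_shear_isIntegral_of_relation`.
-/

noncomputable section

open MvPolynomial

-- the summit and the problem share the name `ValiantsHypothesis` (D-0017 single-conjunct layout)
set_option linter.dupNamespace false

namespace Summit.ValiantsHypothesis.ValiantsHypothesis.Theorems.LangWeilTransfer

variable {F₀ : Type*} [Field F₀] [CharZero F₀]

/-- **One round of integer Noether normalisation, quantitative.** If `f ≠ 0` is a relation of
`a : Fin (i+1) → F₀` over `ℚ`, there is `w ∈ {0, …, deg f}^i` such that `a 0` is integral over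
`ℚ[a_{k+1} - w_k a_0 : k]`. -/
theorem exists_shear_isIntegral_of_relation {i : ℕ} (a : Fin (i + 1) → F₀) (f : MvPolynomial (Fin (i + 1)) ℚ)
    (hf : f ≠ 0) (hfa : aeval a f = 0) :
    ∃ w : Fin i → ℕ, (∀ k, w k ≤ f.totalDegree) ∧
      IsIntegral (Algebra.adjoin ℚ (Set.range fun k : Fin i => a k.succ - (w k : F₀) * a 0)) (a 0) := by
  classical
  set N := f.totalDegree with hN
  let S : Finset ℚ := Finset.image (fun n : ℕ => (n : ℚ)) (Finset.range (N + 1))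
  have hS : f.totalDegree < S.card := by
    rw [Finset.card_image_of_injective _ Nat.cast_injective, Finset.card_range]; omega
  obtain ⟨v, hvS, c, hc0, hmon, -⟩ :=
    Literature.RingTheory.NoetherNormalization.exists_linearChange_monic hf S hS
  have hw : ∀ k, ∃ n : ℕ, n ≤ N ∧ (n : ℚ) = v k := fun k => by
    obtain ⟨n, hn, hn'⟩ := Finset.mem_image.1 (hvS k)
    exact ⟨n, by rw [Finset.mem_range] at hn; omega, hn'⟩
  choose w hwN hw using hw
  refine ⟨w, hwN, ?_⟩
  set a' : Fin i → F₀ := fun k => a k.succ - (w k : F₀) * a 0 with ha'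
  set g := Literature.RingTheory.NoetherNormalization.linearChange v (C c * f) with hg
  -- the relation survives the shear: `g(a 0, a') = (C c * f)(a) = 0`
  have hrel : aeval (Fin.cons (a 0) a' : Fin (i + 1) → F₀) g = 0 := by
    have hcomp := MvPolynomial.comp_aeval (R := ℚ)
      (f := (Fin.cons (X 0) fun k => X k.succ + C (v k) * X 0 : Fin (i + 1) → MvPolynomial (Fin (i + 1)) ℚ))
      (aeval (Fin.cons (a 0) a' : Fin (i + 1) → F₀))
    have hpt : (fun j => aeval (Fin.cons (a 0) a' : Fin (i + 1) → F₀)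
        ((Fin.cons (X 0) fun k => X k.succ + C (v k) * X 0 : Fin (i + 1) → MvPolynomial (Fin (i + 1)) ℚ) j)) = a := by
      funext j
      refine Fin.cases ?_ (fun k => ?_) j
      · simp only [Fin.cons_zero, aeval_X]
      · simp only [Fin.cons_succ, Fin.cons_zero, map_add, map_mul, aeval_X, ha', ← hw k, map_natCast]
        ring
    rw [hpt] at hcomp
    have h := congrArg (fun φ => φ (C c * f)) hcomp
    simp only [AlgHom.comp_apply] at h
    rw [hg, Literature.RingTheory.NoetherNormalization.linearChange, h, map_mul, hfa, mul_zero]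
  -- the monic polynomial over `ℚ[a']`
  set R₁ : Subalgebra ℚ F₀ := Algebra.adjoin ℚ (Set.range a') with hR₁
  let ρ₁ : MvPolynomial (Fin i) ℚ →ₐ[ℚ] R₁ :=
    aeval fun k => (⟨a' k, Algebra.subset_adjoin ⟨k, rfl⟩⟩ : R₁)
  have hρ₁ : (algebraMap R₁ F₀).comp ρ₁.toRingHom = (aeval a' : MvPolynomial (Fin i) ℚ →ₐ[ℚ] F₀).toRingHom := by
    have : (R₁.val).comp ρ₁ = aeval a' := by
      rw [MvPolynomial.comp_aeval]; rfl
    exact congrArg AlgHom.toRingHom this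
  refine ⟨(finSuccEquiv ℚ i g).map ρ₁.toRingHom, hmon.map _, ?_⟩
  rw [Polynomial.eval₂_map, hρ₁]
  have h := Literature.AlgebraicGeometry.Motives.TwoPointPencil.aeval_cons_eq_aevalTower a' (a 0) g
  have h' : Polynomial.eval₂ (aeval a' : MvPolynomial (Fin i) ℚ →ₐ[ℚ] F₀).toRingHom (a 0) (finSuccEquiv ℚ i g) =
      Polynomial.aevalTower (aeval a' : MvPolynomial (Fin i) ℚ →ₐ[ℚ] F₀) (a 0) (finSuccEquiv ℚ i g) := rfl
  rw [h', ← h]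
  exact hrel

end Summit.ValiantsHypothesis.ValiantsHypothesis.Theorems.LangWeilTransfer
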